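import Summits.QuantumFields.YangMills.Theorems.IR.Negative.OnsetMixingTypicalFalseOfMassWire
import Summits.QuantumFields.YangMills.Theorems.IR.Negative.OuterCertInert
import Literature.MathematicalPhysics.QuantumFieldTheory.LatticeGaugeProofs

/-!
# Typical-data tempering is inert at fixed `(β, b)`: format T's only freedom over the g0 format is `b = b(β, δ)`
(Q-g18 disprove lineage, g3; Negative lane of crux `BalabanLadder.IR`, item stmt-QuantumFields-19354)

`OnsetFormats` (sibling module `OnsetMixingTypicalFalseOfMassWire`) mirrors the EXPIRED g0 stub format
`UnivShellCond` / `OnsetMixing` (skeleton 022967c699dbe563) and the REGISTERED T format `TypShellCond` /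
`OnsetMixingTypical` (skeleton 0308f95ca6f6a115) and proves `UnivShellCond → TypShellCond … δ` for every `δ`.
Here the converse AT FIXED PARAMETERS (the T-analogue of `OuterCertInert.univShellCond_of_forall_outerTemperedCond`
for v10): for a continuous representation of a compact second-countable group,

  `univShellCond_of_forall_typShellCond : (∀ δ > 0, TypShellCond ρ β b n ε δ) → UnivShellCond ρ β b n ε`.

So `⋂_δ TypShellCond(β, b, δ) = UnivShellCond(β, b)`: the registered stub `∀ δ > 0, ∃ β₂, ∀ β ≥ β₂, ∃ b, TypShellCond`
differs from the expired `∃ β₂, ∀ β ≥ β₂, ∃ b, UnivShellCond` ONLY through the dependence `b = b(β, δ)` (the mesh may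
grow as the rarity budget shrinks) — one quantifier move, exactly as v10's certificate versus `PhysicalStrongMixing`
(`OuterCertInertIff`).  In particular every H-world in which some mesh bound `b ≤ b̄(β)` is forced refutes the T stub as
soon as it refutes the g0 stub; the sup-`ζ` wires escape T only by pushing `b(β, δ) → ∞` as `δ ↓ 0` (header of the
sibling module).

Proof (kernel-checked, no `sorry`).  New w.r.t. v10: (1) clause (iii_T) with `δ < 1` and
`isProbabilityMeasure_wilsonMeasure` make every `Typ c` NONEMPTY (`typ_nonempty_of_anchor`); (2) splicing one witness
per cell along the disjoint cell edge sets gives ONE datum typical on every cell (`exists_forall_mem_typ`), which is an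
admissible boundary condition for the hereditary rarity clause (ii_T) with `F' =` shell resp. window-off-`Y` cells and
`F = {c}`; (3) the uniform lower density bound `exists_pi_map_glueWith_le_ymSpecification` turns kernel rarity `≤ δ`
into product-Haar co-mass `≤ δ / c`; (4) since (i_T) wants BOTH data typical on every cell off `Y` (also on the
window cells off `Y`, where they agree), the modification is two-stage — a common window part `u` and independent
shell parts `v, v'` — found inside a product box of the open set where the kernel averages move by `< κ/2`
(Feller continuity `continuous_integral_ymSpecification_of_isCylinder`, `isOpen_prod_iff`), by three union bounds.
-/

noncomputable section

open Filter Topology MeasureTheory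
open Literature.MathematicalPhysics.QuantumFieldTheory Literature.MathematicalPhysics.QuantumLattice
open Literature.Probability.LatticeModels
open Summit.QuantumFields.YangMills.Cruxes.IR.Tempered (cellEdges windowCells regionEdges cellEdges_subset_regionEdges)
open Summit.QuantumFields.YangMills.Cruxes.IR.ShellTempered (windowCellsPlus)
open Summit.QuantumFields.YangMills.Cruxes.IR.OuterCertWire (not_mem_cellEdges_of_ne)
open Summit.QuantumFields.YangMills.Cruxes.IR.OuterCertInert (exists_pi_map_glueWith_le_ymSpecification
  continuous_integral_ymSpecification_of_isCylinder)
open Summit.QuantumFields.YangMills.Cruxes.IR.OnsetFormats (UnivShellCond TypShellCond)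

namespace Summit.QuantumFields.YangMills.Cruxes.IR.OnsetFormatsInert

variable {G : Type} [Group G] [TopologicalSpace G] [IsTopologicalGroup G] [CompactSpace G]
  [MeasurableSpace G] [BorelSpace G]

/-! ## §1 Every typical set is nonempty (torus anchor at `δ < 1`), hence one datum is typical everywhere -/

/-- Clause (iii_T) at a singleton with `δ < 1`: on a torus large enough for the cell, the atypical lifts have Wilson
mass `≤ δ < 1 =` total mass, so some periodic lift is typical. -/
theorem typ_nonempty_of_anchor {N : ℕ} {ρ : G →* Matrix (Fin N) (Fin N) ℂ} (hρ : Continuous ρ) {β : ℝ} {b : ℕ}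
    {w : Fin 4 → ℤ → ℤ} {Typ : (Fin 4 → ℤ) → Set (LGConfig 4 G)} {δ : ℝ} (hδ1 : δ < 1)
    (hiii : ∀ S : ℕ, 4 * b ≤ 2 * S + 1 → ∀ F : Finset (Fin 4 → ℤ), F.Nonempty →
        (∀ c ∈ F, ∀ i, -(S : ℤ) ≤ w i (c i) ∧ w i (c i + 1) ≤ (S : ℤ) + 1) →
          (wilsonMeasure (d := 4) (L := 2 * S + 1) ρ β)
              {V : GaugeConfig 4 (2 * S + 1) G | ∀ c ∈ F, torusLift (2 * S + 1) V ∉ Typ c} ≤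
            ENNReal.ofReal (δ ^ F.card))
    (c : Fin 4 → ℤ) : ∃ U : LGConfig 4 G, U ∈ Typ c := by
  set S : ℕ := 2 * b + ∑ i, ((w i (c i)).natAbs + (w i (c i + 1)).natAbs) with hS
  have h4b : 4 * b ≤ 2 * S + 1 := by omega
  have hfit : ∀ c' ∈ ({c} : Finset (Fin 4 → ℤ)), ∀ i, -(S : ℤ) ≤ w i (c' i) ∧ w i (c' i + 1) ≤ (S : ℤ) + 1 := by
    intro c' hc' i
    rw [Finset.mem_singleton] at hc'
    subst hc'
    have h1 : (w i (c' i)).natAbs + (w i (c' i + 1)).natAbs ≤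
        ∑ j, ((w j (c' j)).natAbs + (w j (c' j + 1)).natAbs) :=
      Finset.single_le_sum (f := fun j => (w j (c' j)).natAbs + (w j (c' j + 1)).natAbs)
        (fun _ _ => Nat.zero_le _) (Finset.mem_univ i)
    constructor <;> omega
  have h := hiii S h4b {c} (Finset.singleton_nonempty c) hfit
  simp only [Finset.mem_singleton, forall_eq, Finset.card_singleton, pow_one] at h
  haveI := isProbabilityMeasure_wilsonMeasure (d := 4) (L := 2 * S + 1) (G := G) ρ hρ β
  by_contra hno
  push Not at hno
  have huniv : {V : GaugeConfig 4 (2 * S + 1) G | torusLift (2 * S + 1) V ∉ Typ c} = Set.univ :=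
    Set.eq_univ_of_forall fun V => hno _
  rw [huniv, measure_univ] at h
  exact absurd h (not_le.2 (ENNReal.ofReal_lt_one.2 hδ1))

omit [TopologicalSpace G] [IsTopologicalGroup G] [CompactSpace G] [MeasurableSpace G] [BorelSpace G] in
/-- Splicing one witness per cell along the (pairwise disjoint) cell edge sets of a frame gives a datum that is
typical on EVERY cell (`Typ c` reads only the edges of cell `c`). -/
theorem exists_forall_mem_typ {b : ℕ} {w : Fin 4 → ℤ → ℤ}
    (hw : ∀ i j, w i j + ((b : ℕ) : ℤ) ≤ w i (j + 1) ∧ w i (j + 1) ≤ w i j + 2 * ((b : ℕ) : ℤ))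
    {Typ : (Fin 4 → ℤ) → Set (LGConfig 4 G)}
    (hdep : ∀ c, DependsOn (fun σ : LGConfig 4 G => σ ∈ Typ c) ↑(cellEdges w c))
    (hne : ∀ c, ∃ U : LGConfig 4 G, U ∈ Typ c) : ∃ ζ : LGConfig 4 G, ∀ c, ζ ∈ Typ c := by
  classical
  choose wit hwit using hne
  refine ⟨fun e => if h : ∃ c, e ∈ cellEdges w c then wit h.choose e else 1, fun c => ?_⟩
  refine (hdep c (fun e he => ?_)).mpr (hwit c)
  have he' : e ∈ cellEdges w c := Finset.mem_coe.1 he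
  have h : ∃ c, e ∈ cellEdges w c := ⟨c, he'⟩
  have hc : h.choose = c := by
    by_contra hne'
    exact not_mem_cellEdges_of_ne hw hne' h.choose_spec he'
  show (if h : ∃ c, e ∈ cellEdges w c then wit h.choose e else 1) = wit c e
  rw [dif_pos h, hc]

/-! ## §2 Inertness at fixed `(β, b)` for the typical-data format -/

omit [TopologicalSpace G] [IsTopologicalGroup G] [CompactSpace G] [MeasurableSpace G] [BorelSpace G] in
/-- Union bound: a set of mass `≥ q` is not covered by `#I` sets of mass `≤ a` each when `#I · a < q`. -/
private theorem exists_mem_forall_not_mem {X : Type*} [MeasurableSpace X] (π : Measure X) {ι : Type*}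
    (I : Finset ι) (B : ι → Set X) {a q : ℝ} (hB : ∀ c ∈ I, π (B c) ≤ ENNReal.ofReal a)
    (hlt : (I.card : ℝ) * a < q) (hq : 0 < q) (W : Set X) (hW : ENNReal.ofReal q ≤ π W) :
    ∃ x ∈ W, ∀ c ∈ I, x ∉ B c := by
  by_contra hne
  push Not at hne
  have hsub : W ⊆ ⋃ c ∈ I, B c := fun x hx => by
    obtain ⟨c, hc, hx'⟩ := hne x hx
    exact Set.mem_iUnion₂.2 ⟨c, hc, hx'⟩
  have hbad : π (⋃ c ∈ I, B c) ≤ ENNReal.ofReal ((I.card : ℝ) * a) := by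
    calc π (⋃ c ∈ I, B c) ≤ ∑ c ∈ I, π (B c) := measure_biUnion_finset_le I _
      _ ≤ I.card • ENNReal.ofReal a := Finset.sum_le_card_nsmul _ _ _ hB
      _ = ENNReal.ofReal ((I.card : ℝ) * a) := by
          rw [nsmul_eq_mul, ENNReal.ofReal_mul (Nat.cast_nonneg _), ENNReal.ofReal_natCast]
  exact absurd ((hW.trans (measure_mono hsub)).trans hbad) (not_le.2 ((ENNReal.ofReal_lt_ofReal_iff hq).2 hlt))

omit [TopologicalSpace G] [IsTopologicalGroup G] [CompactSpace G] [MeasurableSpace G] [BorelSpace G] in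
/-- The rarity budget: `0 < δ < 1` with `m · δ / c_S < q` and `k · δ / c_W < q`. -/
private theorem delta_budget {q cS cW : ℝ} (hq : 0 < q) (hcS : 0 < cS) (hcW : 0 < cW) (m k : ℕ) :
    ∃ δ : ℝ, 0 < δ ∧ δ < 1 ∧ (m : ℝ) * (δ / cS) < q ∧ (k : ℝ) * (δ / cW) < q := by
  set δS : ℝ := q * cS / (2 * ((m : ℝ) + 1)) with hδSdef
  set δW : ℝ := q * cW / (2 * ((k : ℝ) + 1)) with hδWdef
  have hδSpos : 0 < δS := by positivity
  have hδWpos : 0 < δW := by positivity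
  have hltS : (m : ℝ) * (δS / cS) < q := by
    have h1 : (m : ℝ) * (δS / cS) = q * ((m : ℝ) / (2 * ((m : ℝ) + 1))) := by
      rw [hδSdef]; field_simp
    have h2 : (m : ℝ) / (2 * ((m : ℝ) + 1)) < 1 := by
      rw [div_lt_one (by positivity : (0 : ℝ) < 2 * ((m : ℝ) + 1))]
      linarith
    rw [h1]
    exact mul_lt_of_lt_one_right hq h2
  have hltW : (k : ℝ) * (δW / cW) < q := by
    have h1 : (k : ℝ) * (δW / cW) = q * ((k : ℝ) / (2 * ((k : ℝ) + 1))) := by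
      rw [hδWdef]; field_simp
    have h2 : (k : ℝ) / (2 * ((k : ℝ) + 1)) < 1 := by
      rw [div_lt_one (by positivity : (0 : ℝ) < 2 * ((k : ℝ) + 1))]
      linarith
    rw [h1]
    exact mul_lt_of_lt_one_right hq h2
  refine ⟨min (min δS δW) (1 / 2), lt_min (lt_min hδSpos hδWpos) (by norm_num),
    (min_le_right _ _).trans_lt (by norm_num), ?_, ?_⟩
  · calc (m : ℝ) * (min (min δS δW) (1 / 2) / cS) ≤ (m : ℝ) * (δS / cS) :=
          mul_le_mul_of_nonneg_left
            (div_le_div_of_nonneg_right ((min_le_left _ _).trans (min_le_left _ _)) hcS.le) (Nat.cast_nonneg _)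
      _ < q := hltS
  · calc (k : ℝ) * (min (min δS δW) (1 / 2) / cW) ≤ (k : ℝ) * (δW / cW) :=
          mul_le_mul_of_nonneg_left
            (div_le_div_of_nonneg_right ((min_le_left _ _).trans (min_le_right _ _)) hcW.le) (Nat.cast_nonneg _)
      _ < q := hltW

omit [TopologicalSpace G] [IsTopologicalGroup G] [CompactSpace G] [MeasurableSpace G] [BorelSpace G] in
/-- The window lies inside the window-plus-shell. -/
private theorem windowCells_subset_windowCellsPlus (n : ℕ) : windowCells n ⊆ windowCellsPlus n := by
  intro c hc
  simp only [windowCells, windowCellsPlus, Fintype.mem_piFinset, Finset.mem_Icc] at hc ⊢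
  intro i
  constructor <;> linarith [(hc i).1, (hc i).2]

/-- **Typical-data tempering is inert at fixed parameters.**  For a continuous representation `ρ` of a compact
second-countable group: if `TypShellCond ρ β b n ε δ` holds for EVERY `δ > 0` (same `ρ, β, b, n, ε`), then the
untempered g0 condition `UnivShellCond ρ β b n ε` holds. -/
theorem univShellCond_of_forall_typShellCond [SecondCountableTopology G] {N : ℕ}
    {ρ : G →* Matrix (Fin N) (Fin N) ℂ} (hρ : Continuous ρ) {β : ℝ} {b n : ℕ} {ε : ℝ}
    (h : ∀ δ : ℝ, 0 < δ → TypShellCond ρ β b n ε δ) : UnivShellCond ρ β b n ε := by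
  classical
  intro w hw Y hY h0 σ σ' hagree f hf hfm hf01
  -- regions: the kernel region, the shell cells, the window cells off `Y`, their edge sets and Haar measures
  set Λ : Finset (Literature.MathematicalPhysics.QuantumLattice.ZdEdge 4) := regionEdges w Y with hΛdef
  set Sh : Finset (Fin 4 → ℤ) := (windowCellsPlus n).filter fun c => c ∉ windowCells n with hShdef
  set WY : Finset (Fin 4 → ℤ) := (windowCells n).filter fun c => c ∉ Y with hWYdef
  set ES : Finset (Literature.MathematicalPhysics.QuantumLattice.ZdEdge 4) := regionEdges w Sh with hESdef
  set EW : Finset (Literature.MathematicalPhysics.QuantumLattice.ZdEdge 4) := regionEdges w WY with hEWdef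
  set πS : Measure (↥ES → G) := Measure.pi fun _ : ↥ES => haarProbability G with hπSdef
  set πW : Measure (↥EW → G) := Measure.pi fun _ : ↥EW => haarProbability G with hπWdef
  have hWP := windowCells_subset_windowCellsPlus n
  -- edge bookkeeping
  have hsubS : ∀ c ∈ Sh, cellEdges w c ⊆ ES := fun c hc e he => by
    rw [hESdef]; exact Finset.mem_biUnion.2 ⟨c, hc, he⟩
  have hsubW : ∀ c ∈ WY, cellEdges w c ⊆ EW := fun c hc e he => by
    rw [hEWdef]; exact Finset.mem_biUnion.2 ⟨c, hc, he⟩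
  have hEW_not_ES : ∀ e ∈ EW, e ∉ ES := by
    intro e heW heS
    rw [hEWdef] at heW
    rw [hESdef] at heS
    obtain ⟨c, hc, he⟩ := Finset.mem_biUnion.1 heW
    obtain ⟨c', hc', he'⟩ := Finset.mem_biUnion.1 heS
    have hcw : c ∈ windowCells n := (Finset.mem_filter.1 hc).1
    have hc'w : c' ∉ windowCells n := (Finset.mem_filter.1 hc').2
    exact not_mem_cellEdges_of_ne hw (fun hcc : c = c' => hc'w (hcc ▸ hcw)) he he'
  have hEW_agree : ∀ e ∈ EW, σ e = σ' e := by
    intro e heW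
    rw [hEWdef] at heW
    obtain ⟨c, hc, he⟩ := Finset.mem_biUnion.1 heW
    have hcw : c ∈ windowCells n := (Finset.mem_filter.1 hc).1
    exact hagree c (hWP hcw) (Finset.mem_filter.1 hc).2 hcw e he
  -- the observable's kernel average as a continuous function of the datum
  set E : LGConfig 4 G → ℝ := fun η => ∫ U, f U ∂(ymSpecification ρ β Λ η) with hEdef
  have hfC : ∀ U, |f U| ≤ 1 := fun U => abs_le.2 ⟨by linarith [(hf01 U).1], (hf01 U).2⟩
  have hEcont : Continuous E :=
    continuous_integral_ymSpecification_of_isCylinder ρ hρ β Λ hfm hf (cellEdges_subset_regionEdges w h0) hfC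
  -- two-stage modifications: a common window part `u`, a shell part `v`
  set gl : (↥ES → G) × (↥EW → G) → LGConfig 4 G → LGConfig 4 G :=
    fun p τ => glueWith ES p.1 (glueWith EW p.2 τ) with hgldef
  have hglc : ∀ τ : LGConfig 4 G, Continuous fun p : (↥ES → G) × (↥EW → G) => gl p τ := by
    intro τ
    have hin : Continuous fun p : (↥ES → G) × (↥EW → G) => glueWith EW p.2 τ :=
      (continuous_glueWith_prod EW).comp (continuous_const.prodMk continuous_snd)
    exact (continuous_glueWith_prod ES).comp (hin.prodMk continuous_fst)
  have hgl_ES : ∀ (p : (↥ES → G) × (↥EW → G)) (τ : LGConfig 4 G) (e) (he : e ∈ ES), gl p τ e = p.1 ⟨e, he⟩ :=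
    fun p τ e he => by simp only [hgldef, glueWith_apply_mem _ _ _ he]
  have hgl_EW : ∀ (p : (↥ES → G) × (↥EW → G)) (τ : LGConfig 4 G) (e) (he : e ∈ EW), gl p τ e = p.2 ⟨e, he⟩ :=
    fun p τ e he => by
      simp only [hgldef, glueWith_apply_not_mem _ _ _ (hEW_not_ES e he), glueWith_apply_mem _ _ _ he]
  have hgl_off : ∀ (p : (↥ES → G) × (↥EW → G)) (τ : LGConfig 4 G) (e), e ∉ ES → e ∉ EW → gl p τ e = τ e :=
    fun p τ e heS heW => by
      simp only [hgldef, glueWith_apply_not_mem _ _ _ heS, glueWith_apply_not_mem _ _ _ heW]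
  -- base points reproducing σ and σ'
  set p₀ : (↥ES → G) × (↥EW → G) := (fun e => σ e, fun e => σ e) with hp₀def
  set p₀' : (↥ES → G) × (↥EW → G) := (fun e => σ' e, fun e => σ e) with hp₀'def
  have hgl0 : gl p₀ σ = σ := by
    funext e
    by_cases heS : e ∈ ES
    · rw [hgl_ES p₀ σ e heS]
    · by_cases heW : e ∈ EW
      · rw [hgl_EW p₀ σ e heW]
      · rw [hgl_off p₀ σ e heS heW]
  have hgl0' : gl p₀' σ' = σ' := by
    funext e
    by_cases heS : e ∈ ES
    · rw [hgl_ES p₀' σ' e heS]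
    · by_cases heW : e ∈ EW
      · rw [hgl_EW p₀' σ' e heW]
        exact hEW_agree e heW
      · rw [hgl_off p₀' σ' e heS heW]
  -- it suffices to prove the bound up to an arbitrary κ > 0
  refine le_of_forall_pos_le_add fun κ hκ => ?_
  -- open sets of modifications moving the two kernel averages by < κ/2, and product boxes inside them
  set O₁ : Set ((↥ES → G) × (↥EW → G)) := {p | |E (gl p σ) - E σ| < κ / 2} with hO₁def
  set O₂ : Set ((↥ES → G) × (↥EW → G)) := {p | |E (gl p σ') - E σ'| < κ / 2} with hO₂def
  have hO₁o : IsOpen O₁ :=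
    isOpen_lt (continuous_abs.comp ((hEcont.comp (hglc σ)).sub continuous_const)) continuous_const
  have hO₂o : IsOpen O₂ :=
    isOpen_lt (continuous_abs.comp ((hEcont.comp (hglc σ')).sub continuous_const)) continuous_const
  have hp₀ : p₀ ∈ O₁ := by
    show |E (gl p₀ σ) - E σ| < κ / 2
    rw [hgl0, sub_self, abs_zero]; positivity
  have hp₀' : p₀' ∈ O₂ := by
    show |E (gl p₀' σ') - E σ'| < κ / 2
    rw [hgl0', sub_self, abs_zero]; positivity
  obtain ⟨s, t, hso, hto, hs0, ht0, hst⟩ := isOpen_prod_iff.1 hO₁o p₀.1 p₀.2 hp₀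
  obtain ⟨s', t', hs'o, ht'o, hs'0, ht'0, hs't'⟩ := isOpen_prod_iff.1 hO₂o p₀'.1 p₀'.2 hp₀'
  have htt0 : p₀.2 ∈ t ∩ t' := ⟨ht0, ht'0⟩
  have hspos : 0 < πS s := hso.measure_pos πS ⟨_, hs0⟩
  have hs'pos : 0 < πS s' := hs'o.measure_pos πS ⟨_, hs'0⟩
  have htpos : 0 < πW (t ∩ t') := (hto.inter ht'o).measure_pos πW ⟨_, htt0⟩
  have hfins : πS s ≠ ⊤ := measure_ne_top πS s
  have hfins' : πS s' ≠ ⊤ := measure_ne_top πS s'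
  have hfint : πW (t ∩ t') ≠ ⊤ := measure_ne_top πW (t ∩ t')
  -- the rarity level δ
  set q : ℝ := min (min (πS s).toReal (πS s').toReal) (πW (t ∩ t')).toReal with hqdef
  have hqpos : 0 < q :=
    lt_min (lt_min (ENNReal.toReal_pos hspos.ne' hfins) (ENNReal.toReal_pos hs'pos.ne' hfins'))
      (ENNReal.toReal_pos htpos.ne' hfint)
  obtain ⟨cS, hcS, hlowS⟩ := exists_pi_map_glueWith_le_ymSpecification ρ hρ β ES
  obtain ⟨cW, hcW, hlowW⟩ := exists_pi_map_glueWith_le_ymSpecification ρ hρ β EW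
  obtain ⟨δ, hδpos, hδ1, hltS, hltW⟩ := delta_budget hqpos hcS hcW Sh.card WY.card
  -- the typical sets at level δ, and one datum typical everywhere
  obtain ⟨Typ, hTm, hTdep, hi, hii, hiii⟩ := h δ hδpos w hw
  obtain ⟨ζs, hζs⟩ := exists_forall_mem_typ hw hTdep (typ_nonempty_of_anchor hρ hδ1 hiii)
  -- kernel rarity of each cell's atypical set, from (ii_T) with `F = {c}` and the typical boundary datum `ζs`
  have hrare : ∀ (F' : Finset (Fin 4 → ℤ)) (c : Fin 4 → ℤ), c ∈ F' →
      ymSpecification ρ β (regionEdges w F') ζs (Typ c)ᶜ ≤ ENNReal.ofReal δ := by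
    intro F' c hc
    have h1 := hii {c} F' (Finset.singleton_subset_iff.2 hc) (Finset.singleton_nonempty c) ζs
      (fun c' _ _ => hζs c')
    simp only [Finset.mem_singleton, forall_eq, Finset.card_singleton, pow_one] at h1
    exact h1
  -- product-Haar co-mass of each cell's atypical set, glued into ANY datum
  have hπS : ∀ (τ : LGConfig 4 G), ∀ c ∈ Sh,
      πS ((glueWith ES · τ) ⁻¹' (Typ c)ᶜ) ≤ ENNReal.ofReal (δ / cS) := by
    intro τ c hc
    have heq : (glueWith ES · τ) ⁻¹' (Typ c)ᶜ = (glueWith ES · ζs) ⁻¹' (Typ c)ᶜ := by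
      ext v
      simp only [Set.mem_preimage, Set.mem_compl_iff]
      exact not_congr (Iff.of_eq (hTdep c fun e he => by
        simp only [glueWith_apply_mem _ _ _ (hsubS c hc (Finset.mem_coe.1 he))]))
    rw [heq, ENNReal.ofReal_div_of_pos hcS]
    refine (ENNReal.le_div_iff_mul_le (Or.inl (ENNReal.ofReal_pos.2 hcS).ne')
      (Or.inl ENNReal.ofReal_ne_top)).2 ?_
    rw [mul_comm]
    exact (hlowS ζs (Typ c)ᶜ (hTm c).compl).trans (hrare Sh c hc)
  have hπW : ∀ (τ : LGConfig 4 G), ∀ c ∈ WY,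
      πW ((glueWith EW · τ) ⁻¹' (Typ c)ᶜ) ≤ ENNReal.ofReal (δ / cW) := by
    intro τ c hc
    have heq : (glueWith EW · τ) ⁻¹' (Typ c)ᶜ = (glueWith EW · ζs) ⁻¹' (Typ c)ᶜ := by
      ext v
      simp only [Set.mem_preimage, Set.mem_compl_iff]
      exact not_congr (Iff.of_eq (hTdep c fun e he => by
        simp only [glueWith_apply_mem _ _ _ (hsubW c hc (Finset.mem_coe.1 he))]))
    rw [heq, ENNReal.ofReal_div_of_pos hcW]
    refine (ENNReal.le_div_iff_mul_le (Or.inl (ENNReal.ofReal_pos.2 hcW).ne')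
      (Or.inl ENNReal.ofReal_ne_top)).2 ?_
    rw [mul_comm]
    exact (hlowW ζs (Typ c)ᶜ (hTm c).compl).trans (hrare WY c hc)
  -- an open set of shell (resp. window) modifications of mass ≥ q contains one typical on every shell (window) cell
  have hexS : ∀ (τ : LGConfig 4 G) (W : Set (↥ES → G)), ENNReal.ofReal q ≤ πS W →
      ∃ v ∈ W, ∀ c ∈ Sh, glueWith ES v τ ∈ Typ c := by
    intro τ W hWq
    obtain ⟨v, hv, hvc⟩ := exists_mem_forall_not_mem πS Sh (fun c => (glueWith ES · τ) ⁻¹' (Typ c)ᶜ) (hπS τ)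
      hltS hqpos W hWq
    exact ⟨v, hv, fun c hc => by simpa using hvc c hc⟩
  have hexW : ∀ (τ : LGConfig 4 G) (W : Set (↥EW → G)), ENNReal.ofReal q ≤ πW W →
      ∃ u ∈ W, ∀ c ∈ WY, glueWith EW u τ ∈ Typ c := by
    intro τ W hWq
    obtain ⟨u, hu, huc⟩ := exists_mem_forall_not_mem πW WY (fun c => (glueWith EW · τ) ⁻¹' (Typ c)ᶜ) (hπW τ)
      hltW hqpos W hWq
    exact ⟨u, hu, fun c hc => by simpa using huc c hc⟩
  -- choose the common window part, then the two shell parts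
  obtain ⟨u, hutt, huT⟩ := hexW σ (t ∩ t')
    ((ENNReal.ofReal_le_ofReal (min_le_right _ _)).trans (ENNReal.ofReal_toReal hfint).le)
  obtain ⟨v, hvs, hvT⟩ := hexS (glueWith EW u σ) s
    ((ENNReal.ofReal_le_ofReal ((min_le_left _ _).trans (min_le_left _ _))).trans
      (ENNReal.ofReal_toReal hfins).le)
  obtain ⟨v', hv's, hv'T⟩ := hexS (glueWith EW u σ') s'
    ((ENNReal.ofReal_le_ofReal ((min_le_left _ _).trans (min_le_right _ _))).trans
      (ENNReal.ofReal_toReal hfins').le)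
  have hX : (v, u) ∈ O₁ := hst (Set.mk_mem_prod hvs hutt.1)
  have hX' : (v', u) ∈ O₂ := hs't' (Set.mk_mem_prod hv's hutt.2)
  -- the modified pair is admissible for (i_T): typical on every cell off Y, equal on the window cells off Y
  have htyp : ∀ c ∈ windowCellsPlus n, c ∉ Y → gl (v, u) σ ∈ Typ c ∧ gl (v', u) σ' ∈ Typ c := by
    intro c hc hcY
    by_cases hcw : c ∈ windowCells n
    · have hcWY : c ∈ WY := Finset.mem_filter.2 ⟨hcw, hcY⟩
      have key : ∀ (x : ↥ES → G) (τ : LGConfig 4 G), gl (x, u) τ ∈ Typ c ↔ glueWith EW u σ ∈ Typ c := by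
        intro x τ
        exact Iff.of_eq (hTdep c fun e he => by
          have heW : e ∈ EW := hsubW c hcWY (Finset.mem_coe.1 he)
          rw [hgl_EW (x, u) τ e heW, glueWith_apply_mem _ _ _ heW])
      exact ⟨(key v σ).2 (huT c hcWY), (key v' σ').2 (huT c hcWY)⟩
    · have hcSh : c ∈ Sh := Finset.mem_filter.2 ⟨hc, hcw⟩
      exact ⟨hvT c hcSh, hv'T c hcSh⟩
  have hagree' : ∀ c ∈ windowCellsPlus n, c ∉ Y → c ∈ windowCells n →
      ∀ e ∈ cellEdges w c, gl (v, u) σ e = gl (v', u) σ' e := by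
    intro c _ hcY hcw e he
    have heW : e ∈ EW := hsubW c (Finset.mem_filter.2 ⟨hcw, hcY⟩) he
    rw [hgl_EW (v, u) σ e heW, hgl_EW (v', u) σ' e heW]
  have hmid : |E (gl (v, u) σ) - E (gl (v', u) σ')| ≤ ε :=
    hi Y hY h0 (gl (v, u) σ) (gl (v', u) σ') htyp hagree' f hf hfm hf01
  have h1 : |E (gl (v, u) σ) - E σ| < κ / 2 := hX
  have h2 : |E (gl (v', u) σ') - E σ'| < κ / 2 := hX'
  show |E σ - E σ'| ≤ ε + κ
  have h3 := abs_sub_le (E σ) (E (gl (v, u) σ)) (E σ')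
  have h4 := abs_sub_le (E (gl (v, u) σ)) (E (gl (v', u) σ')) (E σ')
  rw [abs_sub_comm] at h1
  linarith only [hmid, h1, h2, h3, h4]

/-- Corollary: at fixed `(ρ, β, b, n, ε)` the typical-data condition at all budgets is EQUIVALENT to the untempered
g0 condition (`OnsetFormats.typShellCond_of_univShellCond` is the other direction). -/
theorem forall_typShellCond_iff_univShellCond [SecondCountableTopology G] {N : ℕ}
    {ρ : G →* Matrix (Fin N) (Fin N) ℂ} (hρ : Continuous ρ) {β : ℝ} {b n : ℕ} {ε : ℝ} :
    (∀ δ : ℝ, 0 < δ → TypShellCond ρ β b n ε δ) ↔ UnivShellCond ρ β b n ε :=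
  ⟨univShellCond_of_forall_typShellCond hρ,
    fun hU δ _ => Summit.QuantumFields.YangMills.Cruxes.IR.OnsetFormats.typShellCond_of_univShellCond hU δ⟩

end Summit.QuantumFields.YangMills.Cruxes.IR.OnsetFormatsInert

end
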